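import Literature.IUT.HodgeTheaters.DiscreteProfiniteConjugatesProofs
import Literature.IUT.HodgeTheaters.SurfaceGroupBridge
import Literature.Topology.FourManifolds.SurfaceGroupResiduallyFinite
import HarnessLib

/-!
# [IUTchI] Lemma 2.7 (ii): the surface-group half — proof-only companion

Mochizuki, *Inter-universal Teichmüller theory I*, kurims manuscript (May 2020), §2, Lemma 2.7 (ii)
p. 57–58 [cite: Mochizuki2012, Lem 2.7(ii) pp.57-58]: for `G` a free group of finite rank OR an
orientable surface group and `x ≠ 1` in `G`, there is a finite index subgroup `G₁ ∋ x` in whose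
abelianization `x` is nontrivial.  The printed proof: "Since `G` is residually finite … it suffices
to take `G₁` to be the subgroup of `G` generated by `G₀` and `x`."  The companion
`DiscreteProfiniteConjugatesProofs.lean` (p404938) proved the free half and reduced the named
statement `FreeOrSurface.separatesInAbelianization` to the residual finiteness of orientable
surface groups (`separatesInAbelianization_of_surfaceResiduallyFinite`).  This file supplies that
input — `Literature.Topology.FourManifolds.surfaceGroup_residuallyFinite` (our algebraic proof via
Baumslag's theorem on cyclic amalgams of free groups), transported along the identification of
the two presentations of `S_g` in the tree (generators `Fin g ⊕ Fin g` here, `Fin g × Bool` in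
`Literature/Topology/FourManifolds/GroupTrisections.lean`; bridge `exists_mulEquiv_surfaceGroup`
of `SurfaceGroupBridge.lean`, abc-iut-L5-d1) — and DISCHARGES the named fact:
`FreeOrSurface.separatesInAbelianization_holds`.

By [IUTchI] Remark 2.8.1 (pp. 59–60) only the free, non-proper case of Cor. 2.8 is used later in
the series; the surface half closes the named statement as typed.  No new definitions.
-/

namespace Literature.IUT.HodgeTheaters

namespace FreeOrSurface

universe u

/-- **Orientable surface groups are residually finite** (in the sense of `IsOrientableSurfaceGroup`:
`G ≅ S_g` for some `g ≥ 2`): the input "since `G` is residually finite" of the printed proof of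
Lemma 2.7 (ii), p. 58, for the surface case. [cite: Mochizuki2012, Lem 2.7(ii) p.58] -/
theorem isOrientableSurfaceGroup_residuallyFinite {G : Type u} [Group G]
    (hG : IsOrientableSurfaceGroup G) : Group.ResiduallyFinite G := by
  obtain ⟨g, -, ⟨e⟩⟩ := hG
  obtain ⟨b⟩ := exists_mulEquiv_surfaceGroup g
  haveI := Literature.Topology.FourManifolds.surfaceGroup_residuallyFinite g
  exact residuallyFinite_of_mulEquiv (e.trans b)

/-- **Lemma 2.7 (ii) holds** ([IUTchI] p. 57): for `G` free of finite rank or an orientable surface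
group and `x ≠ 1`, some finite index subgroup `G₁ ∋ x` has `x` nontrivial in `G₁^{ab}` — the named
statement `FreeOrSurface.separatesInAbelianization`, DISCHARGED (free half p404938; surface half
= residual finiteness of surface groups, this file). [cite: Mochizuki2012, Lem 2.7(ii) p.57] -/
theorem separatesInAbelianization_holds : separatesInAbelianization.{u} :=
  separatesInAbelianization_of_surfaceResiduallyFinite
    fun _ _ hG => isOrientableSurfaceGroup_residuallyFinite hG

end FreeOrSurface

end Literature.IUT.HodgeTheaters
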